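import Mathlib

/-!
# Crux `SlicedKelvin.PlanarFluxAPriori` (stmt-NavierStokesRegularity-15600), line `registered`:
  calculus along the plane chart `y ↦ R (y₀, y₁, c)` (helper for the stub `stub_epsFoldLaw`)

The ε-fold law `Theorems.SlicedKelvin.EpsFoldLawOn` (proved for smooth, divergence-free, cubically
decaying fields by the registered stub `stub_epsFoldLaw` of the skeleton
`Cruxes/PlanarFluxAPriori/Lines/birth.lean`) is obtained from a POINTWISE identity on `ℝ³` whose
remainder is an in-plane divergence `∂₀X₀ + ∂₁X₁` (directional derivatives along `R e₀`, `R e₁`),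
integrated over the plane `R{x₂ = c}` through the chart `P y = R (y₀, y₁, c)`, `y ∈ ℝ²`. This file
supplies the three chart facts that turn "in-plane divergence" into "integrates to zero":

* `hasFDerivAt_planeChart` — the chart is affine, `P y = y₀ • R e₀ + y₁ • R e₁ + c • R e₂`, with
  derivative the linear map `L_R = proj₀ ⊗ R e₀ + proj₁ ⊗ R e₁`; `planeChartDeriv_apply_single` —
  `L_R eᵢ = R eᵢ` (`i = 0, 1`); hence the chain rule `fderiv_comp_planeChart_apply_single`:
  `∂_{yᵢ} (g ∘ P)(y) = Dg(P y)[R eᵢ]`.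
* `norm_le_norm_planeChart` — `‖y‖ ≤ ‖P y‖`, so cubic decay on `ℝ³` restricts to cubic decay on the
  plane, which is integrable on `ℝ²` (`integrable_comp_planeChart_of_decay`, Mathlib's
  `integrable_one_add_norm` with `2 < 3`).
* `integral_fderiv_planeChart_eq_zero` (registered sub-goal) — for a differentiable `g : ℝ³ → ℝ`
  with `g ∘ P` and `(Dg[R eᵢ]) ∘ P` integrable on `ℝ²`, `∫_{ℝ²} Dg(P y)[R eᵢ] dy = 0`: Mathlib's
  whole-space integration by parts `integral_mul_fderiv_eq_neg_fderiv_mul_of_integrable` on `ℝ²`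
  against the constant function `1`.

Mathlib only; no fluid mechanics enters.
-/

noncomputable section

-- Problem = summit for this single-conjunct summit: the duplicate namespace component is deliberate.
set_option linter.dupNamespace false

namespace Summit.NavierStokesRegularity.NavierStokesRegularity.Theorems.SlicedKelvinPlanarFluxAPriori

open MeasureTheory

/-- The lift `y ↦ (y₀, y₁, c)` followed by a linear isometry does not decrease norms:
`‖y‖ ≤ ‖R (y₀, y₁, c)‖`. -/
theorem norm_le_norm_planeChart (R : EuclideanSpace ℝ (Fin 3) ≃ₗᵢ[ℝ] EuclideanSpace ℝ (Fin 3))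
    (c : ℝ) (y : EuclideanSpace ℝ (Fin 2)) :
    ‖y‖ ≤ ‖R (WithLp.toLp 2 ![y 0, y 1, c])‖ := by
  rw [LinearIsometryEquiv.norm_map, EuclideanSpace.norm_eq, EuclideanSpace.norm_eq]
  apply Real.sqrt_le_sqrt
  simp only [Fin.sum_univ_two, Fin.sum_univ_three, Real.norm_eq_abs, sq_abs]
  simp
  nlinarith [sq_nonneg c]

/-- The plane `(y₀, y₁, c)` decomposes along the standard frame:
`(y₀, y₁, c) = y₀ • e₀ + y₁ • e₁ + c • e₂`. -/
theorem planeLift_eq_sum_smul_single (c : ℝ) (y : EuclideanSpace ℝ (Fin 2)) :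
    (WithLp.toLp 2 ![y 0, y 1, c] : EuclideanSpace ℝ (Fin 3)) =
      (y 0) • EuclideanSpace.single 0 1 + (y 1) • EuclideanSpace.single 1 1 +
        c • EuclideanSpace.single 2 1 := by
  ext i
  fin_cases i <;> simp

/-- The chart `P y = R (y₀, y₁, c)` in the frame `R`: `P y = y₀ • R e₀ + y₁ • R e₁ + c • R e₂`. -/
theorem planeChart_eq_sum_smul (R : EuclideanSpace ℝ (Fin 3) ≃ₗᵢ[ℝ] EuclideanSpace ℝ (Fin 3))
    (c : ℝ) (y : EuclideanSpace ℝ (Fin 2)) :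
    R (WithLp.toLp 2 ![y 0, y 1, c]) =
      (y 0) • R (EuclideanSpace.single 0 1) + (y 1) • R (EuclideanSpace.single 1 1) +
        c • R (EuclideanSpace.single 2 1) := by
  rw [planeLift_eq_sum_smul_single, map_add, map_add, map_smul, map_smul, map_smul]

/-- **The plane chart is affine.** `y ↦ R (y₀, y₁, c)` has derivative the constant linear map
`L_R = proj₀ ⊗ R e₀ + proj₁ ⊗ R e₁` at every point. -/
theorem hasFDerivAt_planeChart (R : EuclideanSpace ℝ (Fin 3) ≃ₗᵢ[ℝ] EuclideanSpace ℝ (Fin 3))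
    (c : ℝ) (y : EuclideanSpace ℝ (Fin 2)) :
    HasFDerivAt (fun y : EuclideanSpace ℝ (Fin 2) => R (WithLp.toLp 2 ![y 0, y 1, c]))
      ((EuclideanSpace.proj 0 : EuclideanSpace ℝ (Fin 2) →L[ℝ] ℝ).smulRight (R (EuclideanSpace.single 0 1)) +
        (EuclideanSpace.proj 1 : EuclideanSpace ℝ (Fin 2) →L[ℝ] ℝ).smulRight (R (EuclideanSpace.single 1 1))) y := by
  have hfun : (fun y : EuclideanSpace ℝ (Fin 2) => R (WithLp.toLp 2 ![y 0, y 1, c])) =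
      fun y => ((EuclideanSpace.proj 0 : EuclideanSpace ℝ (Fin 2) →L[ℝ] ℝ).smulRight (R (EuclideanSpace.single 0 1)) +
        (EuclideanSpace.proj 1 : EuclideanSpace ℝ (Fin 2) →L[ℝ] ℝ).smulRight (R (EuclideanSpace.single 1 1))) y +
          c • R (EuclideanSpace.single 2 1) := by
    funext y
    rw [planeChart_eq_sum_smul]
    rfl
  rw [hfun]
  exact (ContinuousLinearMap.hasFDerivAt _).add_const _

/-- The chart derivative sends the standard frame of `ℝ²` to the in-plane frame:
`L_R eᵢ = R eᵢ` for `i = 0, 1`. -/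
theorem planeChartDeriv_apply_single (R : EuclideanSpace ℝ (Fin 3) ≃ₗᵢ[ℝ] EuclideanSpace ℝ (Fin 3))
    (i : Fin 2) :
    ((EuclideanSpace.proj 0 : EuclideanSpace ℝ (Fin 2) →L[ℝ] ℝ).smulRight (R (EuclideanSpace.single 0 1)) +
        (EuclideanSpace.proj 1 : EuclideanSpace ℝ (Fin 2) →L[ℝ] ℝ).smulRight (R (EuclideanSpace.single 1 1)))
      (EuclideanSpace.single i (1 : ℝ)) = R (EuclideanSpace.single (Fin.castSucc i) 1) := by
  fin_cases i <;> simp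

/-- The plane chart is continuous. -/
theorem continuous_planeChart (R : EuclideanSpace ℝ (Fin 3) ≃ₗᵢ[ℝ] EuclideanSpace ℝ (Fin 3))
    (c : ℝ) : Continuous (fun y : EuclideanSpace ℝ (Fin 2) => R (WithLp.toLp 2 ![y 0, y 1, c])) :=
  continuous_iff_continuousAt.2 fun y => (hasFDerivAt_planeChart R c y).continuousAt

/-- **Chain rule along the chart.** For `g` differentiable at `P y`,
`y ↦ g (P y)` has derivative `Dg(P y) ∘ L_R` at `y`. -/
theorem hasFDerivAt_comp_planeChart {G : Type*} [NormedAddCommGroup G] [NormedSpace ℝ G]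
    (R : EuclideanSpace ℝ (Fin 3) ≃ₗᵢ[ℝ] EuclideanSpace ℝ (Fin 3)) (c : ℝ)
    {g : EuclideanSpace ℝ (Fin 3) → G} {g' : EuclideanSpace ℝ (Fin 3) →L[ℝ] G}
    (y : EuclideanSpace ℝ (Fin 2)) (hg : HasFDerivAt g g' (R (WithLp.toLp 2 ![y 0, y 1, c]))) :
    HasFDerivAt (fun y : EuclideanSpace ℝ (Fin 2) => g (R (WithLp.toLp 2 ![y 0, y 1, c])))
      (g'.comp ((EuclideanSpace.proj 0 : EuclideanSpace ℝ (Fin 2) →L[ℝ] ℝ).smulRight (R (EuclideanSpace.single 0 1)) +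
        (EuclideanSpace.proj 1 : EuclideanSpace ℝ (Fin 2) →L[ℝ] ℝ).smulRight (R (EuclideanSpace.single 1 1)))) y :=
  hg.comp y (hasFDerivAt_planeChart R c y)

/-- **Partial derivatives along the chart are in-plane directional derivatives**:
`∂_{yᵢ} (g ∘ P)(y) = Dg(P y)[R eᵢ]` for `g` differentiable at `P y` and `i = 0, 1`. -/
theorem fderiv_comp_planeChart_apply_single {G : Type*} [NormedAddCommGroup G] [NormedSpace ℝ G]
    (R : EuclideanSpace ℝ (Fin 3) ≃ₗᵢ[ℝ] EuclideanSpace ℝ (Fin 3)) (c : ℝ)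
    {g : EuclideanSpace ℝ (Fin 3) → G} (y : EuclideanSpace ℝ (Fin 2))
    (hg : DifferentiableAt ℝ g (R (WithLp.toLp 2 ![y 0, y 1, c]))) (i : Fin 2) :
    fderiv ℝ (fun y : EuclideanSpace ℝ (Fin 2) => g (R (WithLp.toLp 2 ![y 0, y 1, c]))) y
        (EuclideanSpace.single i 1) =
      fderiv ℝ g (R (WithLp.toLp 2 ![y 0, y 1, c])) (R (EuclideanSpace.single (Fin.castSucc i) 1)) := by
  rw [(hasFDerivAt_comp_planeChart R c y hg.hasFDerivAt).fderiv, ContinuousLinearMap.comp_apply,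
    planeChartDeriv_apply_single]

/-- `y ↦ g (P y)` is differentiable when `g` is. -/
theorem differentiable_comp_planeChart {G : Type*} [NormedAddCommGroup G] [NormedSpace ℝ G]
    (R : EuclideanSpace ℝ (Fin 3) ≃ₗᵢ[ℝ] EuclideanSpace ℝ (Fin 3)) (c : ℝ)
    {g : EuclideanSpace ℝ (Fin 3) → G} (hg : Differentiable ℝ g) :
    Differentiable ℝ (fun y : EuclideanSpace ℝ (Fin 2) => g (R (WithLp.toLp 2 ![y 0, y 1, c]))) :=
  fun y => (hasFDerivAt_comp_planeChart R c y (hg _).hasFDerivAt).differentiableAt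

/-- **Cubic decay on `ℝ³` is integrable on every plane.** If `g` is continuous with
`(1 + ‖x‖)³ ‖g x‖ ≤ K`, then `y ↦ g (R (y₀, y₁, c))` is integrable on `ℝ²` (dominated by
`K (1 + ‖y‖)⁻³`, integrable since `2 < 3`). -/
theorem integrable_comp_planeChart_of_decay {G : Type*} [NormedAddCommGroup G]
    (R : EuclideanSpace ℝ (Fin 3) ≃ₗᵢ[ℝ] EuclideanSpace ℝ (Fin 3)) (c : ℝ)
    {g : EuclideanSpace ℝ (Fin 3) → G} (hg : Continuous g) {K : ℝ}
    (hK : ∀ x, (1 + ‖x‖) ^ 3 * ‖g x‖ ≤ K) :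
    Integrable (fun y : EuclideanSpace ℝ (Fin 2) => g (R (WithLp.toLp 2 ![y 0, y 1, c]))) := by
  have hK0 : 0 ≤ K := le_trans (by positivity) (hK 0)
  have hint : Integrable (fun y : EuclideanSpace ℝ (Fin 2) => (1 + ‖y‖) ^ (-(3 : ℝ))) :=
    integrable_one_add_norm (by rw [finrank_euclideanSpace_fin]; norm_num)
  refine (hint.const_mul K).mono' ((hg.comp (continuous_planeChart R c)).aestronglyMeasurable)
    (Filter.Eventually.of_forall fun y => ?_)
  set p : EuclideanSpace ℝ (Fin 3) := R (WithLp.toLp 2 ![y 0, y 1, c]) with hp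
  have hy0 : 0 < 1 + ‖y‖ := by positivity
  have hyp : (1 + ‖y‖) ^ 3 ≤ (1 + ‖p‖) ^ 3 := by
    gcongr
    exact norm_le_norm_planeChart R c y
  rw [Real.rpow_neg hy0.le, show (3 : ℝ) = ((3 : ℕ) : ℝ) by norm_num, Real.rpow_natCast,
    ← div_eq_mul_inv, le_div_iff₀ (by positivity), mul_comm]
  calc (1 + ‖y‖) ^ 3 * ‖g p‖ ≤ (1 + ‖p‖) ^ 3 * ‖g p‖ := by gcongr
    _ ≤ K := hK p

/-- **In-plane derivatives integrate to zero over the plane** (registered sub-goal of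
`stub_epsFoldLaw`). For a differentiable `g : ℝ³ → ℝ` such that `g ∘ P` and `(Dg[R eᵢ]) ∘ P` are
integrable on `ℝ²` (`P y = R (y₀, y₁, c)`, `i = 0, 1`), `∫_{ℝ²} Dg(P y)[R eᵢ] dy = 0`. Proof:
`Dg(P y)[R eᵢ] = ∂_{yᵢ}(g ∘ P)(y)` and Mathlib's integration by parts on the whole space `ℝ²`
(`integral_mul_fderiv_eq_neg_fderiv_mul_of_integrable`, integrable function with integrable
derivative) against the constant `1`. -/
theorem integral_fderiv_planeChart_eq_zero : ∀ (R : EuclideanSpace ℝ (Fin 3) ≃ₗᵢ[ℝ] EuclideanSpace ℝ (Fin 3)) (c : ℝ) (i : Fin 2) (g : EuclideanSpace ℝ (Fin 3) → ℝ), Differentiable ℝ g → MeasureTheory.Integrable (fun y : EuclideanSpace ℝ (Fin 2) => g (R (WithLp.toLp 2 ![y 0, y 1, c]))) → MeasureTheory.Integrable (fun y : EuclideanSpace ℝ (Fin 2) => fderiv ℝ g (R (WithLp.toLp 2 ![y 0, y 1, c])) (R (EuclideanSpace.single (Fin.castSucc i) 1))) → ∫ y : EuclideanSpace ℝ (Fin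 2), fderiv ℝ g (R (WithLp.toLp 2 ![y 0, y 1, c])) (R (EuclideanSpace.single (Fin.castSucc i) 1)) = 0 := by
  intro R c i g hg hgi hDgi
  have hd := differentiable_comp_planeChart R c hg
  -- the integrand is the `i`-th partial derivative of `g ∘ P`
  have hkey : ∀ y : EuclideanSpace ℝ (Fin 2),
      fderiv ℝ g (R (WithLp.toLp 2 ![y 0, y 1, c])) (R (EuclideanSpace.single (Fin.castSucc i) 1)) =
        fderiv ℝ (fun y : EuclideanSpace ℝ (Fin 2) => g (R (WithLp.toLp 2 ![y 0, y 1, c]))) y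
          (EuclideanSpace.single i 1) :=
    fun y => (fderiv_comp_planeChart_apply_single R c y (hg _) i).symm
  simp_rw [hkey] at hDgi ⊢
  have H := integral_mul_fderiv_eq_neg_fderiv_mul_of_integrable (μ := volume)
    (f := fun y : EuclideanSpace ℝ (Fin 2) => g (R (WithLp.toLp 2 ![y 0, y 1, c])))
    (g := fun _ => (1 : ℝ)) (v := EuclideanSpace.single i 1)
    (by simpa using hDgi) (by simp) (by simpa using hgi)
    (fun y _ => hd y) (fun y _ => differentiableAt_const _)
  simpa using H

end Summit.NavierStokesRegularity.NavierStokesRegularity.Theorems.SlicedKelvinPlanarFluxAPriori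

end
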